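/-
Copyright: the b2b-balaban cell (near-miss cell 7), T⁴-continuum fan-out; row NE7b ROUND-2 swarm, seat
t4-ne7b-formalise-leaf-05 gen 4 (row S6g′ INSTANCE of `t4/b2b-balaban-t4-ne7b-p1/LEAVES-NE7b.md`, owner's rulings
R-OWNER-23-3∕-4∕-5: T3b «the physical occupant ↦ a counted placement», file 1 «VALUE»).  Released under the licence of
the surrounding project.
-/
import Summits.QuantumFields.BalabanUV.T4Continuum.Support.HistoryJoinsPlacedTagged
import Summits.QuantumFields.BalabanUV.T4Continuum.Support.HistoryZonesOrbitPlace
import Summits.QuantumFields.BalabanUV.T4Continuum.Support.HistorySiblingEntropySortPhys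
import Summits.QuantumFields.BalabanUV.T4Continuum.Support.HistoryJoinsRearrange

/-!
# T3b, file 1 «VALUE»: the value map of the instance, the payload-tagged label tree, and the placement read off a
# physical member (row S6g′ INSTANCE)

Summits-side support leaf of the T⁴-continuum cell (rung (B)+1 on a FINITE torus only; NOT infinite volume, NOT the
mass gap, NOT the Clay statement; NOT a proof of the spine estimate NE7b).  Row NE7b, route «COUNT», row S6g′
INSTANCE, piece T3b (owner's rulings R-OWNER-23-3∕-4∕-5: S12e's occupant key is ORDER-FREE; its third component is the
multiset of placement VALUES; `valP` is named here).  [folklore] plain functions and bookkeeping over the lineage's own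
carriers (leaf-09's census carrier `PGen`, leaf-10 gen 5's `PGen.pbirths`, leaf-07 gen 2's corner cell `placeD` ∕ region
map `regR` ∕ correspondence `Corr`, leaf-10 gen 4's `Template`∕`mkOfRegion`, gen 3's `regOf`∕`anchorZ`, leaf-02 gen 6's
births' reading `bread`); nothing is quoted from print, nothing printed is asserted, no `[cite:]` tag, no `Prop`-valued
fact minted; the definitions are plain functions (`cellV`, `tmplV`, `valP`, `toGenL`, `pl`, `placeL`, `placeP`).

WHAT.
* §1 **`valP n L K hN M hM lv : PEv → Pt d × Finset (Pt d) → TCell d (n·L^K) × Template d M`** — the VALUE of a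
  physical birth `(label, (anchor, region))`: the corner cell `cellV` of the anchor at the level `lv label.step` (leaf-07
  gen 2's `placeD`, as a function of (step, anchor)) and the template `tmplV` = `mkOfRegion` of «region − anchor» when
  «anchor ∈ region ∧ face-connected ∧ treeLen ≤ fat ∧ tcap d fat ≤ M», else the one-cube template; `cellV_val`,
  `isScale_cellV`, `blk_cellV`, `card_tmplV_le : #(tmplV …) ≤ tcap d f` (unconditional), and THE IDENTITY
  **`redZone_translate_valP`**: in the good case, `redZone N (translate (tmplV …) (anchorZ L lv (cellV …) s)) = redZone N region`
  (`N = n·L^{K − lv s}`; a translate by a multiple of `N` does not move the reduced zone) — the placement's region map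
  `regOf` IS leaf-07 gen 2's `regR` on physical births (`regOf_eq_redZone_of_valP`).
* §2 **`toGenL : PGen γ → Gen (PEv × γ)`** — the label tree tagged by its payloads (`relabel Prod.fst ∘ toGenL =
  toGen`, `births_toGenL = pbirths.toFinset`, `baddr_toGenL`, `corr_toGenL : Corr Prod.fst Prod.snd (toGenL g) g`).
* §3 **`placeL c₀ v G′ : Addr D → γ′`** — the placement READ OFF a label tree (value `v b` at the address of the birth
  `b`, junk `c₀` elsewhere; raw form `pl`): `junk_placeL`, `rel_false_placeL`∕`rel_true_placeL` (the partners' relative placements,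
  depth `≤ D`), and for a physical member `g : PGen γ` the placement **`placeP c₀ w g := placeL c₀ (w ·.1 ·.2)
  (toGenL g)`** with **`bread_placeP : bread c₀ g.toGen (placeP c₀ w g) = g.pbirths.map (fun bz => (bz.1, w bz.1 bz.2))`**
  — the bridge «births' reading of the placement read off the member = physical births mapped through the value map»
  of R-OWNER-23-3 (3).

HONEST SCOPE.  Definitions + bookkeeping over OUR carriers; nothing of H3∕(B)∕BetaPertH touched; `hmult` NOT retired;
NE7b NOT proved.  HONEST DEPENDENCY (cell): continuum YM on T⁴ ⇐ BetaPertH ∧ nine spine estimates (0/9 proved); BetaPertH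
⇐ (D1) ∧ (D4) ∧ CAP+tail; G-an2-4 gates asym, D1 and NE2/3/4.  This file changes none of it. -/

open Finset
open Literature.MathematicalPhysics.QuantumFieldTheory.Balaban1983to89
open Literature.MathematicalPhysics.QuantumFieldTheory.Balaban1983to89.B13ScaleTransfer (Pt FaceConnected)
open Literature.MathematicalPhysics.QuantumFieldTheory.Balaban1983to89.TreeLength (treeLen)
open T4PersistenceDictionary T4PartnerMultiplicity T4BranchingRecordsGas
open Summit.QuantumFields.BalabanUV.T4Continuum.PlacementSkeleton
open Summit.QuantumFields.BalabanUV.T4Continuum.ZoneTorus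
open Summit.QuantumFields.BalabanUV.T4Continuum.HistoryZones
open Summit.QuantumFields.BalabanUV.T4Continuum.HistoryAdmissible
open Summit.QuantumFields.BalabanUV.T4Continuum.HistoryJoins
open Summit.QuantumFields.BalabanUV.T4Continuum.HistoryJoinsAdm
open Summit.QuantumFields.BalabanUV.T4Continuum.HistoryJoinsSupTorus
open Summit.QuantumFields.BalabanUV.T4Continuum.HistoryJoinsRearrange
open Summit.QuantumFields.BalabanUV.T4Continuum.HistoryRegionTemplates
open Summit.QuantumFields.BalabanUV.T4Continuum.HistoryJoinsTemplates
open Summit.QuantumFields.BalabanUV.T4Continuum.HistoryJoinsPlacedZone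

namespace Summit.QuantumFields.BalabanUV.T4Continuum.HistoryJoinsPlacedValue

noncomputable section

open scoped Classical

variable {d : ℕ}

/-! ## §1 The value map: corner cell × template -/

section Value

variable (n L K : ℕ) (hN : 0 < n * L ^ K) (lv : ℕ → ℕ)

/-- **THE CORNER CELL** of an anchor cube at the level `lv s`: coordinates `L^{lv s}·(anchor mod n·L^{K − lv s})`
(leaf-07 gen 2's `placeD`, as a function of the step and the anchor). [folklore] -/
def cellV (s : ℕ) (z : Pt d) : TCell d (n * L ^ K) := fun i =>
  ⟨(L ^ lv s * res (n * L ^ (K - lv s)) (z i)) % (n * L ^ K), Nat.mod_lt _ hN⟩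

variable {n L K lv}

/-- leaf-07 gen 2's realised placement is the corner cell of the payload's anchor [folklore] -/
theorem placeD_eq_cellV {ε : Type*} (sh : ε → PEv) (pay : ε → Pt d × Finset (Pt d)) (b : ε) :
    placeD sh pay n L K hN lv b = cellV n L K hN lv (sh b).step (pay b).1 := rfl
/-- no wrap: the coordinates of the corner cell (`lv s ≤ K`, `0 < L`) [folklore] -/
theorem cellV_val (hL : 0 < L) {s : ℕ} (hs : lv s ≤ K) (z : Pt d) (i : Fin d) :
    (cellV n L K hN lv s z i).val = L ^ lv s * res (n * L ^ (K - lv s)) (z i) := by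
  have hn : 0 < n := Nat.pos_of_mul_pos_right hN
  have hlt : res (n * L ^ (K - lv s)) (z i) < n * L ^ (K - lv s) := res_lt (Nat.mul_pos hn (pow_pos hL _)) _
  refine Nat.mod_eq_of_lt ?_
  calc L ^ lv s * res (n * L ^ (K - lv s)) (z i)
      < L ^ lv s * (n * L ^ (K - lv s)) := Nat.mul_lt_mul_of_pos_left hlt (pow_pos hL _)
    _ = n * L ^ K := by rw [mul_left_comm, ← pow_add, Nat.add_sub_cancel' hs]

/-- the corner cell is a cell of its level [folklore] -/
theorem isScale_cellV (hL : 0 < L) {s : ℕ} (hs : lv s ≤ K) (z : Pt d) : IsScale L (lv s) (cellV n L K hN lv s z) :=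
  fun i => by rw [cellV_val hN hL hs]; exact dvd_mul_right _ _

/-- the level block of the corner cell is the reduced anchor [folklore] -/
theorem blk_cellV (hL : 0 < L) {s : ℕ} (hs : lv s ≤ K) (z : Pt d) :
    blk L (lv s) (cellV n L K hN lv s z) = fun i => res (n * L ^ (K - lv s)) (z i) := by
  funext i
  rw [blk, cellV_val hN hL hs, Nat.mul_div_cancel_left _ (pow_pos hL _)]

/-- … as a point of `ℤ^d` (gen 3's `anchorZ`) [folklore] -/
theorem anchorZ_cellV (hL : 0 < L) {s : ℕ} (hs : lv s ≤ K) (z : Pt d) :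
    anchorZ L lv (cellV n L K hN lv s z) s = fun i => ((res (n * L ^ (K - lv s)) (z i) : ℕ) : ℤ) := by
  funext i
  simp only [anchorZ, blk_cellV hN hL hs]

variable (d) in
/-- **THE TEMPLATE OF A PHYSICAL BIRTH**: «region − anchor» read into `Template d M` when the birth facts hold (anchor in
the region, face-connected, `treeLen ≤ fat`) and the type is large enough (`tcap d fat ≤ M`); the one-cube template
otherwise. [folklore] -/
def tmplV (M : ℕ) (hM : 1 ≤ M) (f : ℕ) (zZ : Pt d × Finset (Pt d)) : Template d M :=
  if h : zZ.1 ∈ zZ.2 ∧ FaceConnected zZ.2 ∧ treeLen zZ.2 ≤ (f : ℝ) ∧ tcap d f ≤ M then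
    mkOfRegion h.1 h.2.1 h.2.2.1 h.2.2.2
  else Template.zero hM

/-- in the good case the template translated back to its anchor is the region [folklore] -/
theorem translate_tmplV {M : ℕ} (hM : 1 ≤ M) {f : ℕ} {zZ : Pt d × Finset (Pt d)}
    (h : zZ.1 ∈ zZ.2 ∧ FaceConnected zZ.2 ∧ treeLen zZ.2 ≤ (f : ℝ) ∧ tcap d f ≤ M) :
    translate (tmplV d M hM f zZ) zZ.1 = zZ.2 := by
  rw [tmplV, dif_pos h]
  exact translate_mkOfRegion h.1 h.2.1 h.2.2.1 h.2.2.2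

/-- **THE TEMPLATE HAS AT MOST `tcap d fat` CUBES**, in every case. [folklore] -/
theorem card_tmplV_le {M : ℕ} (hM : 1 ≤ M) (f : ℕ) (zZ : Pt d × Finset (Pt d)) :
    (tmplV d M hM f zZ).1.card ≤ tcap d f := by
  unfold tmplV
  split_ifs with h
  · exact card_val_mkOfRegion_le h.1 h.2.1 h.2.2.1 h.2.2.2
  · have : (Template.zero (d := d) hM).1.card = 1 := by simp [Template.zero]
    rw [this]
    exact one_le_tcap d f

variable (n L K lv)

/-- **THE VALUE MAP OF THE INSTANCE** (R-OWNER-23-4): a physical birth `(label, (anchor, region))` is placed at the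
corner cell of its anchor at the level of its step, carrying the template «region − anchor». [folklore] -/
def valP (M : ℕ) (hM : 1 ≤ M) (b : PEv) (zZ : Pt d × Finset (Pt d)) : TCell d (n * L ^ K) × Template d M :=
  (cellV n L K hN lv b.step zZ.1, tmplV d M hM b.fat zZ)

variable {n L K lv}

/-- reduction forgets multiples of the modulus [folklore] -/
theorem res_add_mul (m : ℕ) (a q : ℤ) : res m (a + (m : ℤ) * q) = res m a := by
  unfold res; rw [Int.add_mul_emod_self_left]

/-- the reduced anchor differs from the anchor by a multiple of the modulus [folklore] -/
theorem exists_res_sub_eq_mul {m : ℕ} (hm : 0 < m) (a : ℤ) : ∃ q : ℤ, ((res m a : ℕ) : ℤ) - a = (m : ℤ) * q := by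
  refine ⟨-(a / (m : ℤ)), ?_⟩
  have h0 : 0 ≤ a % (m : ℤ) := Int.emod_nonneg _ (by exact_mod_cast hm.ne')
  unfold res
  rw [Int.toNat_of_nonneg h0, Int.emod_def]
  ring

/-- **A TRANSLATE BY A MULTIPLE OF THE MODULUS DOES NOT MOVE THE REDUCED ZONE.** [folklore] -/
theorem redZone_image_add_of_dvd {m : ℕ} (S : Finset (Pt d)) {w : Pt d} (hw : ∀ i, ∃ q : ℤ, w i = (m : ℤ) * q) :
    redZone m (S.image (· + w)) = redZone m S := by
  unfold redZone
  rw [image_image]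
  refine image_congr fun x _ => ?_
  funext i
  obtain ⟨q, hq⟩ := hw i
  show res m ((x + w) i) = res m (x i)
  rw [Pi.add_apply, hq, res_add_mul]

/-- **THE IDENTITY**: in the good case the placed template, reduced on the level torus, IS the reduced region
(`N = n·L^{K − lv s}`, `lv s ≤ K`, `0 < L`). [folklore] -/
theorem redZone_translate_valP (hL : 0 < L) {M : ℕ} (hM : 1 ≤ M) {b : PEv} (hs : lv b.step ≤ K)
    {zZ : Pt d × Finset (Pt d)} (h : zZ.1 ∈ zZ.2 ∧ FaceConnected zZ.2 ∧ treeLen zZ.2 ≤ (b.fat : ℝ) ∧ tcap d b.fat ≤ M) :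
    redZone (n * L ^ (K - lv b.step))
        (translate (valP n L K hN lv M hM b zZ).2 (anchorZ L lv (valP n L K hN lv M hM b zZ).1 b.step)) =
      redZone (n * L ^ (K - lv b.step)) zZ.2 := by
  have hn : 0 < n := Nat.pos_of_mul_pos_right hN
  have hNpos : 0 < n * L ^ (K - lv b.step) := Nat.mul_pos hn (pow_pos hL _)
  simp only [valP]
  rw [anchorZ_cellV hN hL hs]
  -- the placed template is the region translated by (reduced anchor − anchor), a multiple of the modulus
  have hT : translate (tmplV d M hM b.fat zZ) (fun i => ((res (n * L ^ (K - lv b.step)) (zZ.1 i) : ℕ) : ℤ)) =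
      zZ.2.image (· + ((fun i => ((res (n * L ^ (K - lv b.step)) (zZ.1 i) : ℕ) : ℤ)) - zZ.1)) := by
    rw [tmplV, dif_pos h]
    unfold HistoryJoinsTemplates.translate
    rw [val_mkOfRegion, image_image]
    refine image_congr fun x _ => ?_
    show x - zZ.1 + _ = x + (_ - zZ.1)
    abel
  rw [hT]
  exact redZone_image_add_of_dvd _ fun i => by
    obtain ⟨q, hq⟩ := exists_res_sub_eq_mul hNpos (zZ.1 i)
    exact ⟨q, by rw [Pi.sub_apply]; exact hq⟩

/-- **THE PLACEMENT's REGION MAP ON A PHYSICAL BIRTH IS THE REDUCED REGION** (gen 3's `regOf` meets leaf-07 gen 2's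
`regR`): if the placement reads `valP b (anchor, region)` at the address `l`, then `regOf … (l, b) = redZone N region`.
[folklore] -/
theorem regOf_eq_redZone_of_valP (hL : 0 < L) {M D : ℕ} (hM : 1 ≤ M) {c₀ : TCell d (n * L ^ K) × Template d M}
    {p : Addr D → TCell d (n * L ^ K) × Template d M} {l : List Bool} {b : PEv} {zZ : Pt d × Finset (Pt d)}
    (hp : evalA c₀ p l = valP n L K hN lv M hM b zZ) (hs : lv b.step ≤ K)
    (h : zZ.1 ∈ zZ.2 ∧ FaceConnected zZ.2 ∧ treeLen zZ.2 ≤ (b.fat : ℝ) ∧ tcap d b.fat ≤ M) :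
    regOf n L K lv c₀ p (l, b) = redZone (n * L ^ (K - lv b.step)) zZ.2 := by
  unfold regOf
  simp only [hp]
  exact redZone_translate_valP hN hL hM hs h

end Value

/-! ## §2 The payload-tagged label tree of a physical member -/

section Label

variable {γ : Type*} [Inhabited γ]

/-- **THE LABEL TREE TAGGED BY PAYLOADS**: leaf-09's canonical label `PGen.toGen` with every birth label carrying its
payload (renewal and merger labels carry the default payload). [folklore] -/
def toGenL : PGen γ → Gen (PEv × γ)
  | PGen.birth j cls x => Gen.born ((((j, 0, cls) : PEv)), x) j
  | PGen.renew G h => Gen.renew (toGenL G) ((((h + 1, 1, 0) : PEv)), default) h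
  | PGen.join X Y s => Gen.merge (toGenL X) (toGenL Y) ((((s, 2, 0) : PEv)), default)

/-- forgetting the payloads gives the canonical label [folklore] -/
theorem relabel_fst_toGenL : ∀ g : PGen γ, relabel Prod.fst (toGenL g) = g.toGen
  | PGen.birth _ _ _ => rfl
  | PGen.renew G h => by simp only [toGenL, PGen.toGen, relabel_renew, relabel_fst_toGenL G]
  | PGen.join X Y s => by simp only [toGenL, PGen.toGen, relabel_merge, relabel_fst_toGenL X, relabel_fst_toGenL Y]

/-- the birth addresses of the tagged label tree are those of the label [folklore] -/
theorem baddr_toGenL (g : PGen γ) : baddr (toGenL g) = baddr g.toGen := by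
  rw [← relabel_fst_toGenL g, baddr_relabel]

/-- **THE BIRTH LABELS OF THE TAGGED TREE ARE THE PHYSICAL BIRTHS** (as a set). [folklore] -/
theorem births_toGenL [DecidableEq γ] : ∀ g : PGen γ, births (toGenL g) = g.pbirths.toFinset
  | PGen.birth j cls x => by simp [toGenL]
  | PGen.renew G h => by simp only [toGenL, births_renew, PGen.pbirths_renew, births_toGenL G]
  | PGen.join X Y s => by
      simp only [toGenL, births_merge, PGen.pbirths_join, Multiset.toFinset_add, births_toGenL X, births_toGenL Y]

/-- the tagged label tree corresponds node by node to the member (leaf-07 gen 2's `Corr`, shape `Prod.fst`, payload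
`Prod.snd`) [folklore] -/
theorem corr_toGenL : ∀ g : PGen (Pt d × Finset (Pt d)), Corr Prod.fst Prod.snd (toGenL g) g
  | PGen.birth _ _ _ => ⟨rfl, rfl, rfl⟩
  | PGen.renew G _ => ⟨rfl, rfl, corr_toGenL G⟩
  | PGen.join X Y _ => ⟨rfl, corr_toGenL X, corr_toGenL Y⟩

/-- a birth label of the tagged tree has the step of its leaf [folklore] -/
theorem leafStep_toGenL : ∀ (g : PGen γ) (b : PEv × γ) (j : ℕ), Sub (Gen.born b j) (toGenL g) → b.1.step = j
  | PGen.birth _ _ _, b, j, hS => by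
      cases hS with
      | refl => rfl
  | PGen.renew G h, b, j, hS => by
      cases hS with
      | renew _ _ hs => exact leafStep_toGenL G b j hs
  | PGen.join X Y s, b, j, hS => by
      cases hS with
      | left _ _ hs => exact leafStep_toGenL X b j hs
      | right _ _ hs => exact leafStep_toGenL Y b j hs

end Label

/-! ## §3 The placement read off a label tree, and its births' reading -/

section Place

variable {ε' γ' : Type*} {D : ℕ} (c₀ : γ') (v : ε' → γ')

/-- the raw reading: the value of the birth at an address of the tree, junk elsewhere [folklore] -/
def pl : Gen ε' → List Bool → γ'
  | Gen.born b _, [] => v b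
  | Gen.born _ _, _ :: _ => c₀
  | Gen.renew G _ _, l => pl G l
  | Gen.merge X _ _, false :: r => pl X r
  | Gen.merge _ Y _, true :: r => pl Y r
  | Gen.merge _ _ _, [] => c₀

/-- off the birth addresses the raw reading is junk [folklore] -/
theorem pl_of_not_mem : ∀ (G : Gen ε') (l : List Bool), l ∉ baddr G → pl c₀ v G l = c₀
  | Gen.born b j, [], h => by simp [baddr] at h
  | Gen.born b j, _ :: _, _ => rfl
  | Gen.renew G e k, l, h => pl_of_not_mem G l (by simpa [baddr] using h)
  | Gen.merge X Y e, [], _ => rfl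
  | Gen.merge X Y e, false :: r, h => by
      simp only [pl]
      exact pl_of_not_mem X r fun hr => h (by
        simp only [baddr, mem_union, mem_image]
        exact Or.inl ⟨r, hr, rfl⟩)
  | Gen.merge X Y e, true :: r, h => by
      simp only [pl]
      exact pl_of_not_mem Y r fun hr => h (by
        simp only [baddr, mem_union, mem_image]
        exact Or.inr ⟨r, hr, rfl⟩)

/-- **THE PLACEMENT READ OFF A LABEL TREE** on the addresses of depth `≤ D`. [folklore] -/
def placeL (G : Gen ε') : Addr D → γ' := fun a => pl c₀ v G a.1

/-- the placement read off a tree is junk off its births (for any relabelling of the tree) [folklore] -/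
theorem junk_placeL {δ : Type*} (f : ε' → δ) (G : Gen ε') : Junk (relabel f G) c₀ (placeL (D := D) c₀ v G) := by
  intro r hr
  exact pl_of_not_mem c₀ v G r.1 (by rwa [baddr_relabel] at hr)

/-- evaluation of the placement, on a tree of depth `≤ D` [folklore] -/
theorem evalA_placeL {G : Gen ε'} (hD : ∀ a ∈ baddr G, a.length ≤ D) (l : List Bool) :
    evalA c₀ (placeL (D := D) c₀ v G) l = pl c₀ v G l := by
  unfold evalA placeL; split_ifs with h
  · rfl
  · exact (pl_of_not_mem c₀ v G l fun hl => h (hD l hl)).symm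

/-- the birth addresses of a partner are one shorter [folklore] -/
theorem depth_left {X Y : Gen ε'} {e : ε'} (hD : ∀ a ∈ baddr (Gen.merge X Y e), a.length ≤ D) :
    ∀ a ∈ baddr X, a.length ≤ D := fun a ha => by
  have h := hD (false :: a) (by simp only [baddr, mem_union, mem_image]; exact Or.inl ⟨a, ha, rfl⟩)
  simp only [List.length_cons] at h; omega

/-- … and of the second partner [folklore] -/
theorem depth_right {X Y : Gen ε'} {e : ε'} (hD : ∀ a ∈ baddr (Gen.merge X Y e), a.length ≤ D) :
    ∀ a ∈ baddr Y, a.length ≤ D := fun a ha => by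
  have h := hD (true :: a) (by simp only [baddr, mem_union, mem_image]; exact Or.inr ⟨a, ha, rfl⟩)
  simp only [List.length_cons] at h; omega

/-- **THE FIRST PARTNER's RELATIVE PLACEMENT IS THE PLACEMENT READ OFF THE FIRST PARTNER** (depth `≤ D`). [folklore] -/
theorem rel_false_placeL {X Y : Gen ε'} {e : ε'} (hD : ∀ a ∈ baddr (Gen.merge X Y e), a.length ≤ D) :
    rel c₀ [false] (placeL (D := D) c₀ v (Gen.merge X Y e)) = placeL c₀ v X := by
  funext r
  rw [rel, List.singleton_append, evalA_placeL c₀ v hD]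
  rfl

/-- … and the second partner's [folklore] -/
theorem rel_true_placeL {X Y : Gen ε'} {e : ε'} (hD : ∀ a ∈ baddr (Gen.merge X Y e), a.length ≤ D) :
    rel c₀ [true] (placeL (D := D) c₀ v (Gen.merge X Y e)) = placeL c₀ v Y := by
  funext r
  rw [rel, List.singleton_append, evalA_placeL c₀ v hD]
  rfl

/-- the value at the root address of a bare birth [folklore] -/
theorem evalA_placeL_born (b : ε') (j : ℕ) : evalA c₀ (placeL (D := D) c₀ v (Gen.born b j)) [] = v b := by
  rw [evalA_placeL c₀ v (G := Gen.born b j) (fun a ha => by simp [baddr] at ha; simp [ha])]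
  rfl

end Place

section PlaceP

variable {γ γ' : Type*} [Inhabited γ] {D : ℕ} (c₀ : γ') (w : PEv → γ → γ')

/-- **THE PLACEMENT READ OFF A PHYSICAL MEMBER**: the value `w label payload` of each physical birth at the address of
its leaf in the label tree. [folklore] -/
def placeP (g : PGen γ) : Addr D → γ' := placeL c₀ (fun b : PEv × γ => w b.1 b.2) (toGenL g)

/-- the placement read off a member is junk off the births of its label [folklore] -/
theorem junk_placeP (g : PGen γ) : Junk g.toGen c₀ (placeP (D := D) c₀ w g) := by
  rw [← relabel_fst_toGenL]
  exact junk_placeL c₀ _ Prod.fst (toGenL g)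

/-- renewals are transparent [folklore] -/
@[simp] theorem placeP_renew (G : PGen γ) (h : ℕ) : placeP (D := D) c₀ w (PGen.renew G h) = placeP c₀ w G := rfl

/-- the partners' relative placements of a join (depth `≤ D`) [folklore] -/
theorem rel_false_placeP {X Y : PGen γ} {s : ℕ} (hD : ∀ a ∈ baddr (PGen.join X Y s).toGen, a.length ≤ D) :
    rel c₀ [false] (placeP (D := D) c₀ w (PGen.join X Y s)) = placeP c₀ w X := by
  rw [← baddr_toGenL] at hD
  exact rel_false_placeL c₀ _ hD

/-- the partners' relative placements of a join (depth `≤ D`) [folklore] -/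
theorem rel_true_placeP {X Y : PGen γ} {s : ℕ} (hD : ∀ a ∈ baddr (PGen.join X Y s).toGen, a.length ≤ D) :
    rel c₀ [true] (placeP (D := D) c₀ w (PGen.join X Y s)) = placeP c₀ w Y := by
  rw [← baddr_toGenL] at hD
  exact rel_true_placeL c₀ _ hD

/-- the root value of a bare birth [folklore] -/
theorem evalA_placeP_birth (j cls : ℕ) (x : γ) :
    evalA c₀ (placeP (D := D) c₀ w (PGen.birth j cls x)) [] = w ((j, 0, cls) : PEv) x :=
  evalA_placeL_born c₀ _ _ _

/-- **THE BRIDGE OF R-OWNER-23-3 (3)**: the births' reading of the placement read off a member IS the member's physical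
birth multiset mapped through the value map (depth `≤ D`). [folklore] -/
theorem bread_placeP : ∀ g : PGen γ, (∀ a ∈ baddr g.toGen, a.length ≤ D) →
    bread c₀ g.toGen (placeP (D := D) c₀ w g) = g.pbirths.map fun bz => (bz.1, w bz.1 bz.2)
  | PGen.birth j cls x, _ => by
      rw [PGen.toGen, bread_born, evalA_placeP_birth]; rfl
  | PGen.renew G h, hD => by
      rw [PGen.toGen, bread_renew, placeP_renew, PGen.pbirths_renew]
      exact bread_placeP G hD
  | PGen.join X Y s, hD => by
      have hD' := hD
      rw [PGen.toGen] at hD'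
      rw [PGen.toGen, bread_merge, rel_false_placeP c₀ w hD, rel_true_placeP c₀ w hD, PGen.pbirths_join,
        Multiset.map_add, bread_placeP X (depth_left hD'), bread_placeP Y (depth_right hD')]

end PlaceP

end

end Summit.QuantumFields.BalabanUV.T4Continuum.HistoryJoinsPlacedValue
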